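import Literature.LinearAlgebra.TensorNetworks.QTTLaplaceInverse

/-!
# The QTT rank table of the Laplace operator and its inverse (Kazeev–Khoromskij 2012, Thm. 4.1), completed

Kazeev–Khoromskij, *Low-rank explicit QTT representation of the Laplace operator and its
inverse*, SIAM J. Matrix Anal. Appl. 33 (2012) 742–758 [KazeevKhoromskij2012]; numbering of
the MPI MIS preprint 75/2010.  THEOREM 4.1 of the paper is a table of eleven upper bounds on the
vector QTT ranks (= the ranks of the unfolding matrices of the quantics reshaping) of the
one-dimensional Laplace matrices, their inverses, and the `D`-dimensional operator (3):

| line of Thm. 4.1 | bound | source in the paper | where proved |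
|---|---|---|---|
| `Δ_DD^{(d)}` | `3 … 3` | Lem. 2.1 | `rank_unfolding_lapTrain_le` (this file) |
| `Δ_DN^{(d)}, Δ_ND^{(d)}` | `4 … 4` | Lem. 2.2 | `rank_unfolding_lapDNTrain_le`, `rank_unfolding_lapNDTrain_le` (this file) |
| `Δ_NN^{(d)}` | `4, 5 … 5, 4` | Lem. 2.2 | `rank_unfolding_lapNNTrain_le/_first_le/_last_le` (`QTTLaplaceNeumannPeriodic`) |
| `Δ_P^{(d)}` | `2, 3 … 3` | Lem. 2.2 | `rank_unfolding_lapPTrain_le/_first_le` (`QTTLaplaceNeumannPeriodic`) |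
| `(Δ_DD^{(d)})⁻¹` | `4, 5 … 5, 4` | Lem. 3.3, Rem. 3.4 | `rank_unfolding_ddInvTrain_le/_first_le/_last_le` (this file) |
| `(Δ_DN^{(d)})⁻¹, (Δ_ND^{(d)})⁻¹` | `4 … 4` | Lem. 3.2 | `rank_unfolding_dnInvTrain_le`, `rank_unfolding_ndInvTrain_le` (this file) |
| `Δ_DD^{(d…d)}` | `3…3, 2, 4…4, 2, …, 2, 4…4, 3` | Cor. 2.4 | `rank_unfolding_lapMultiTrain_le/_junction_le/_head_le/_last_le` (`QTTLaplaceMulti`) |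
| `Δ_DN^{(d…d)}, Δ_ND^{(d…d)}` | `4…4, 2, 5…5, 2, …, 2, 5…5, 4` | Cor. 2.5 | `rank_unfolding_lapMultiDNTrain_…`, `rank_unfolding_lapMultiNDTrain_…` (`QTTLaplaceMultiNeumann`) |
| `Δ_NN^{(d…d)}` | `4, 5…5, 2, 5, 6…6, 5, 2, …, 2, 5, 6…6, 4` | Cor. 2.6 | `rank_unfolding_lapMultiNNTrain_…` (`QTTLaplaceMultiNeumann`) |
| `Δ_P^{(d…d)}` | `2, 3…3, 2, 3, 4…4, 2, …, 2, 3, 4…4, 3` | Cor. 2.7 | `rank_unfolding_lapMultiPTrain_…` (`QTTLaplaceMultiPeriodic`) |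

This file supplies the five lines not yet stated as unfolding-rank bounds in the library — the
one-dimensional `Δ_DD`, `Δ_DN`, `Δ_ND` (whose rank-`3` / rank-`4` trains `lapTrain`, `lapDNTrain`,
`lapNDTrain` are those of `QTTLaplace`) and the inverses (whose rank-`4` / rank-`5` trains
`dnInvTrain`, `ndInvTrain`, `ddInvTrain` are those of `QTTLaplaceInverse`, with
`qttMatrix = (Δ_DN^{(2^d)})⁻¹`, `(Δ_ND^{(2^d)})⁻¹`, `(Δ_DD^{(2^d)})⁻¹` proved there) — so that, with the
files cited in the last column, the whole of Thm. 4.1 is available (for the multi-dimensional lines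
with equal level numbers `d_k = d`).

* "Proof. Follows straightforwardly from the lemmas, corollaries and the remark referred and
  presenting explicit QTT representation of the mentioned ranks."  Formally: the `k`-th unfolding
  matrix of a train factors through its `k`-th bond (`TensorTrain.rank_unfolding_le`), which gives
  the interior entries `3`, `4`, `4`, `5` of the five lines from the bond dimensions of the explicit
  trains.
* THE BOUNDARY `4`s OF `(Δ_DD^{(d)})⁻¹ : 4, 5 … 5, 4`.  The paper obtains them from the explicit
  boundary cores of Rem. 3.4.  They are, however, forced by counting: the first (last) unfolding
  matrix of ANY train on the digit-pair alphabet `{0,1}²` has `4` rows (columns), so its rank is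
  `≤ 4` (two private bookkeeping lemmas: the `k`-th unfolding rank of a train of length `L` on the
  alphabet `σ` is `≤ |σ|^k` and `≤ |σ|^{L-k}`).  We prove the two `4`s this way and do NOT transcribe
  the cores of
  Rem. 3.4, which inherit the misprinted constant factors of Lem. 3.3 recorded in the caveat of
  `QTTLaplaceInverse`.

Not formalised here (honest scope).  The sharpness of the table (Rem. 4.2: "numerical experiments …
prove all the upper bounds … to be sharp") — upper bounds only, throughout the series; the explicit
reduced boundary cores of Rem. 3.4; the multi-dimensional lines with distinct level numbers `d_k`;
§5 (operator TT ranks).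

## References
* [KazeevKhoromskij2012] V. A. Kazeev, B. N. Khoromskij, Low-rank explicit QTT representation of
  the Laplace operator and its inverse, SIAM J. Matrix Anal. Appl. 33(3) (2012) 742–758
  (MPI MIS preprint 75/2010), Thm. 4.1, Lem. 2.1, 2.2, 3.2, 3.3, Rem. 3.4, 4.2.
* [Khoromskij2015] B. N. Khoromskij, Tensor numerical methods for multidimensional PDEs:
  theoretical analysis and initial applications, ESAIM Proc. Surveys 48 (2015) 1–28, §1.5
  (unfolding ranks ≤ bond dimensions).

AI-produced formalisation (H21 engines group, seat eng-quad-2, 2026-08-23); no facts, no axioms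
beyond Mathlib's, no `sorry`.
-/

namespace Literature.LinearAlgebra.TensorNetworks

universe u

open Matrix

/-! ### Unfolding ranks are bounded by the number of rows and of columns -/

namespace TensorTrain

variable {K : Type u} [Field K] {σ : Type*} [Fintype σ] {L : ℕ}

/-- [folklore] THE ROW COUNT BOUND: the `k`-th unfolding matrix of a train on the alphabet `σ`
has `|σ|^k` rows, hence rank `≤ |σ|^k` (bookkeeping; for QTT matrix trains, `|σ| = 4`). -/
private theorem rank_unfolding_le_card_pow_left (T : TensorTrain K σ L) (k m : ℕ) (h : k + m = L) :
    (Matrix.of fun (s : Fin k → σ) (t : Fin m → σ) =>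
        T.eval (fun i => Fin.append s t (i.cast h.symm))).rank ≤ Fintype.card σ ^ k := by
  classical
  calc (Matrix.of fun (s : Fin k → σ) (t : Fin m → σ) =>
          T.eval (fun i => Fin.append s t (i.cast h.symm))).rank
        ≤ Fintype.card (Fin k → σ) := Matrix.rank_le_card_height _
    _ = Fintype.card σ ^ k := by rw [Fintype.card_fun, Fintype.card_fin]

/-- [folklore] THE COLUMN COUNT BOUND: the `k`-th unfolding matrix of a train of length `L = k + m`
on the alphabet `σ` has `|σ|^m` columns, hence rank `≤ |σ|^m` (bookkeeping). -/
private theorem rank_unfolding_le_card_pow_right (T : TensorTrain K σ L) (k m : ℕ) (h : k + m = L) :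
    (Matrix.of fun (s : Fin k → σ) (t : Fin m → σ) =>
        T.eval (fun i => Fin.append s t (i.cast h.symm))).rank ≤ Fintype.card σ ^ m := by
  classical
  calc (Matrix.of fun (s : Fin k → σ) (t : Fin m → σ) =>
          T.eval (fun i => Fin.append s t (i.cast h.symm))).rank
        ≤ Fintype.card (Fin m → σ) := Matrix.rank_le_card_width _
    _ = Fintype.card σ ^ m := by rw [Fintype.card_fun, Fintype.card_fin]

end TensorTrain

/-! ### Theorem 4.1, the one-dimensional lines `Δ_DD^{(d)} : 3 … 3` and `Δ_DN^{(d)}, Δ_ND^{(d)} : 4 … 4` -/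

section OneDimensional

variable {K : Type u} [Field K]

/-- THEOREM 4.1, LINE `Δ_DD^{(d)} : 3 … 3` (Lem. 2.1): every unfolding matrix of the rank-`3` train
`e₀ᵀ ⋈ W ⋈ ⋯ ⋈ W ⋈ (2,-1,-1)ᵀ` of the Dirichlet Laplacian (`lapTrain`, `qttMatrix = Δ_DD^{(2^d)}` in
`QTTLaplace`) has rank `≤ 3`.  [cite: KazeevKhoromskij2012, Thm. 4.1] -/
theorem rank_unfolding_lapTrain_le (d k m : ℕ) (h : k + m = d) :
    (Matrix.of fun (s : Fin k → Fin 2 × Fin 2) (t : Fin m → Fin 2 × Fin 2) =>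
        (lapTrain K d).eval (fun i => Fin.append s t (i.cast h.symm))).rank ≤ 3 :=
  TensorTrain.rank_unfolding_le _ k m h

/-- THEOREM 4.1, LINE `Δ_DN^{(d)} : 4 … 4` (Lem. 2.2): every unfolding matrix of the rank-`4` train
of `Δ_DN` (`lapDNTrain`, cores `diag(W, I₂)`) has rank `≤ 4`.  [cite: KazeevKhoromskij2012, Thm. 4.1] -/
theorem rank_unfolding_lapDNTrain_le (d k m : ℕ) (h : k + m = d) :
    (Matrix.of fun (s : Fin k → Fin 2 × Fin 2) (t : Fin m → Fin 2 × Fin 2) =>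
        (lapDNTrain K d).eval (fun i => Fin.append s t (i.cast h.symm))).rank ≤ 4 :=
  TensorTrain.rank_unfolding_le _ k m h

/-- THEOREM 4.1, LINE `Δ_ND^{(d)} : 4 … 4` (Lem. 2.2, "with `I₂` replaced by `I₁`"): every unfolding
matrix of the rank-`4` train of `Δ_ND` (`lapNDTrain`) has rank `≤ 4`.
[cite: KazeevKhoromskij2012, Thm. 4.1] -/
theorem rank_unfolding_lapNDTrain_le (d k m : ℕ) (h : k + m = d) :
    (Matrix.of fun (s : Fin k → Fin 2 × Fin 2) (t : Fin m → Fin 2 × Fin 2) =>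
        (lapNDTrain K d).eval (fun i => Fin.append s t (i.cast h.symm))).rank ≤ 4 :=
  TensorTrain.rank_unfolding_le _ k m h

end OneDimensional

/-! ### Theorem 4.1, the inverse lines `(Δ_DD^{(d)})⁻¹ : 4, 5 … 5, 4` and `(Δ_DN^{(d)})⁻¹, (Δ_ND^{(d)})⁻¹ : 4 … 4` -/

section Inverse

variable {K : Type u} [Field K]

/-- THEOREM 4.1, LINE `(Δ_DN^{(d)})⁻¹ : 4 … 4` (Lem. 3.2): every unfolding matrix of the rank-`4`
train `e₀ᵀ ⋈ C ⋈ ⋯ ⋈ C ⋈ (1,1,1,1)ᵀ` of `(Δ_DN^{(d)})⁻¹` (`dnInvTrain`; `qttMatrix = (Δ_DN^{(2^d)})⁻¹`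
is `qttMatrix_dnInvTrain_eq_inv` of `QTTLaplaceInverse`) has rank `≤ 4`.
[cite: KazeevKhoromskij2012, Thm. 4.1] -/
theorem rank_unfolding_dnInvTrain_le (d k m : ℕ) (h : k + m = d) :
    (Matrix.of fun (s : Fin k → Fin 2 × Fin 2) (t : Fin m → Fin 2 × Fin 2) =>
        (dnInvTrain K d).eval (fun i => Fin.append s t (i.cast h.symm))).rank ≤ 4 :=
  TensorTrain.rank_unfolding_le _ k m h

/-- THEOREM 4.1, LINE `(Δ_ND^{(d)})⁻¹ : 4 … 4` (the mirror image of Lem. 3.2; the paper records the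
ranks, `QTTLaplaceInverse` the representation `ndInvTrain` with `qttMatrix = (Δ_ND^{(2^d)})⁻¹`):
every unfolding matrix has rank `≤ 4`.  [cite: KazeevKhoromskij2012, Thm. 4.1] -/
theorem rank_unfolding_ndInvTrain_le (d k m : ℕ) (h : k + m = d) :
    (Matrix.of fun (s : Fin k → Fin 2 × Fin 2) (t : Fin m → Fin 2 × Fin 2) =>
        (ndInvTrain K d).eval (fun i => Fin.append s t (i.cast h.symm))).rank ≤ 4 :=
  TensorTrain.rank_unfolding_le _ k m h

/-- THEOREM 4.1, LINE `(Δ_DD^{(d)})⁻¹ : 4, 5 … 5, 4`, THE `5`s (Lem. 3.3): every unfolding matrix of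
the rank-`5` position-dependent train `e₀ᵀ ⋈ C_d ⋈ ⋯ ⋈ C_1 ⋈ H_0` of `(Δ_DD^{(d)})⁻¹` (`ddInvTrain`;
`qttMatrix = (Δ_DD^{(2^d)})⁻¹` is `qttMatrix_ddInvTrain_eq_inv` of `QTTLaplaceInverse`, characteristic
zero) has rank `≤ 5`.  [cite: KazeevKhoromskij2012, Thm. 4.1] -/
theorem rank_unfolding_ddInvTrain_le (d k m : ℕ) (h : k + m = d) :
    (Matrix.of fun (s : Fin k → Fin 2 × Fin 2) (t : Fin m → Fin 2 × Fin 2) =>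
        (ddInvTrain K d).eval (fun i => Fin.append s t (i.cast h.symm))).rank ≤ 5 :=
  TensorTrain.rank_unfolding_le _ k m h

/-- THEOREM 4.1, LINE `(Δ_DD^{(d)})⁻¹ : 4, 5 … 5, 4`, THE LEADING `4` (Rem. 3.4): across the first bond
the unfolding matrix of `ddInvTrain` has rank `≤ 4` — here by the row count (it has `4` rows, one per
digit pair `(i₁, j₁)`); the paper exhibits the reduced first core `W_d` of Rem. 3.4 instead.
[cite: KazeevKhoromskij2012, Thm. 4.1] -/
theorem rank_unfolding_ddInvTrain_first_le (d m : ℕ) (h : 1 + m = d) :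
    (Matrix.of fun (s : Fin 1 → Fin 2 × Fin 2) (t : Fin m → Fin 2 × Fin 2) =>
        (ddInvTrain K d).eval (fun i => Fin.append s t (i.cast h.symm))).rank ≤ 4 :=
  (TensorTrain.rank_unfolding_le_card_pow_left _ 1 m h).trans_eq (by simp)

/-- THEOREM 4.1, LINE `(Δ_DD^{(d)})⁻¹ : 4, 5 … 5, 4`, THE TRAILING `4` (Rem. 3.4): across the last bond
the unfolding matrix of `ddInvTrain` has rank `≤ 4` — by the column count (`4` columns, one per digit
pair `(i_d, j_d)`); the paper exhibits the reduced last cores `W_2 ⋈ W_1` of Rem. 3.4 instead.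
[cite: KazeevKhoromskij2012, Thm. 4.1] -/
theorem rank_unfolding_ddInvTrain_last_le (d k : ℕ) (h : k + 1 = d) :
    (Matrix.of fun (s : Fin k → Fin 2 × Fin 2) (t : Fin 1 → Fin 2 × Fin 2) =>
        (ddInvTrain K d).eval (fun i => Fin.append s t (i.cast h.symm))).rank ≤ 4 :=
  (TensorTrain.rank_unfolding_le_card_pow_right _ k 1 h).trans_eq (by simp)

end Inverse

end Literature.LinearAlgebra.TensorNetworks
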